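import Literature.MathematicalPhysics.QuantumLattice.DWaveSourceProofs
import Literature.MathematicalPhysics.QuantumLattice.LiebFluxPhaseProofs
import Literature.MathematicalPhysics.QuantumLattice.SectorSpectrum

/-!
# Crux `TwSeededEnsembleEquivalence` (stmt-HubbardSuperconductivity-1698), line `exposed-density-duality` — stub `stub_closer`

THE CLOSER of the line (lead prover): ground-sector existence + "`S^z = 0` realises the even sector
minimum" + an `L`-uniform `T = 0` one-particle cost + EXPOSED DENSITY at `T = 0` (the transfer)
⟹ HULL TOUCH: the `(N_L, S^z = 0)`-sector ground energy of the seeded canonical Hamiltonian touches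
the supporting line of slope `μ₀` of the grand-canonical ground energy `E₀(Hgc_L(μ₀))` up to `o(L²)`.

Proof (pure real analysis over the four hypotheses; no matrix fact is used here):
* KINK LEMMA (`kink_lemma`): pointwise convergence `F_L(μ)/L² → e(μ)` near `μ₀` and
  `HasDerivAt e (−(1−δ)) μ₀` pin both one-sided secants of `F_L/L²` at `μ₀` over a step `τ` to
  within `η` of `−(1−δ)`, eventually in `L`;
* SUPERGRADIENT BRACKET: `F_L(μ) = min_N (E_N − μN)` is attained at a ground sector `N*` (first
  hypothesis) and `F_L(μ₀ ± τ) ≤ E_{N*} − (μ₀ ± τ)N*`, so `−N*` lies between the two secants: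
  `|N* − (1−δ)L²| ≤ ηL²`, whence `|N* − N_L| ≤ ηL² + 2`;
* WALK (`walk_down`/`walk_up`): `≤ ηL² + 2` one-particle steps from `N*` to `N_L`, each costing
  `≤ 2C` in energy (third hypothesis, sectors between `L²/2` and `L²`) and `≤ 4` in `μ₀N`;
* `S^z = 0` realises `E_{N_L}` (second hypothesis, `N_L` even), and `η := ε/(2(2C+4))`,
  `L² ≥ 4(2C+4)/ε` finish.
-/

namespace Summit.HubbardSuperconductivity.HubbardSuperconductivity.Theorems.TwSeededEnsembleEquivalence.ExposedDensity

open Matrix Filter Topology Literature.MathematicalPhysics.QuantumLattice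
open scoped ComplexOrder Matrix.Norms.L2Operator

noncomputable section

/-! ### Real-analysis helpers -/

/-- **Kink lemma** (pure real analysis): pointwise convergence near `μ₀` plus differentiability of
the limit at `μ₀` pins the one-sided secant slopes of the approximants over some step `τ ≤ r`,
eventually in `L`. (Adapted from the crux ideation sketch `Cruxes/…/Sketch-ideator1.lean`,
`kink_lemma`, where it was first proved.) [folklore] -/
private theorem kink_lemma (f : ℕ → ℝ → ℝ) (e : ℝ → ℝ) (μ₀ d r : ℝ) (hr : 0 < r)
    (hlim : ∀ μ ∈ Set.Icc (μ₀ - r) (μ₀ + r), Tendsto (fun L => f L μ) atTop (𝓝 (e μ)))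
    (hd : HasDerivAt e d μ₀) :
    ∀ η : ℝ, 0 < η → ∃ τ : ℝ, 0 < τ ∧ τ ≤ r ∧ ∃ L₀ : ℕ, ∀ L, L₀ ≤ L →
      |(f L (μ₀ + τ) - f L μ₀) / τ - d| ≤ η ∧ |(f L μ₀ - f L (μ₀ - τ)) / τ - d| ≤ η := by
  intro η hη
  have hslope := hd.tendsto_slope_zero
  rw [Metric.tendsto_nhdsWithin_nhds] at hslope
  obtain ⟨δ, hδ, hδ'⟩ := hslope (η / 2) (by linarith)
  set τ : ℝ := min (δ / 2) r with hτ
  have hτpos : 0 < τ := lt_min (by linarith) hr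
  have hτr : τ ≤ r := min_le_right _ _
  have hτδ : τ < δ := lt_of_le_of_lt (min_le_left _ _) (by linarith)
  refine ⟨τ, hτpos, hτr, ?_⟩
  have hmem0 : μ₀ ∈ Set.Icc (μ₀ - r) (μ₀ + r) := ⟨by linarith, by linarith⟩
  have hmemp : μ₀ + τ ∈ Set.Icc (μ₀ - r) (μ₀ + r) := ⟨by linarith, by linarith⟩
  have hmemm : μ₀ - τ ∈ Set.Icc (μ₀ - r) (μ₀ + r) := ⟨by linarith, by linarith⟩
  have hε : 0 < η * τ / 4 := by positivity
  obtain ⟨N0, hN0⟩ := Metric.tendsto_atTop.1 (hlim μ₀ hmem0) (η * τ / 4) hε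
  obtain ⟨Np, hNp⟩ := Metric.tendsto_atTop.1 (hlim (μ₀ + τ) hmemp) (η * τ / 4) hε
  obtain ⟨Nm, hNm⟩ := Metric.tendsto_atTop.1 (hlim (μ₀ - τ) hmemm) (η * τ / 4) hε
  refine ⟨max N0 (max Np Nm), fun L hL => ?_⟩
  have hL0 : N0 ≤ L := le_trans (le_max_left _ _) hL
  have hLp : Np ≤ L := le_trans (le_trans (le_max_left _ _) (le_max_right _ _)) hL
  have hLm : Nm ≤ L := le_trans (le_trans (le_max_right _ _) (le_max_right _ _)) hL
  have e0 := hN0 L hL0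
  have ep := hNp L hLp
  have em := hNm L hLm
  rw [Real.dist_eq] at e0 ep em
  have sp := hδ' (x := τ) (by simp [hτpos.ne'])
    (by rw [dist_zero_right, Real.norm_eq_abs, abs_of_pos hτpos]; exact hτδ)
  have sm := hδ' (x := -τ) (by simp [hτpos.ne'])
    (by rw [dist_zero_right, Real.norm_eq_abs, abs_neg, abs_of_pos hτpos]; exact hτδ)
  rw [Real.dist_eq] at sp sm
  simp only [smul_eq_mul] at sp sm
  have hτne : τ ≠ 0 := hτpos.ne'
  constructor
  · have key : (f L (μ₀ + τ) - f L μ₀) / τ - d =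
        (τ⁻¹ * (e (μ₀ + τ) - e μ₀) - d) + ((f L (μ₀ + τ) - e (μ₀ + τ)) - (f L μ₀ - e μ₀)) / τ := by
      field_simp
      ring
    rw [key]
    have h1 : |τ⁻¹ * (e (μ₀ + τ) - e μ₀) - d| ≤ η / 2 := sp.le
    have h2 : |((f L (μ₀ + τ) - e (μ₀ + τ)) - (f L μ₀ - e μ₀)) / τ| ≤ η / 2 := by
      rw [abs_div, abs_of_pos hτpos, div_le_iff₀ hτpos]
      calc |(f L (μ₀ + τ) - e (μ₀ + τ)) - (f L μ₀ - e μ₀)|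
          ≤ |f L (μ₀ + τ) - e (μ₀ + τ)| + |f L μ₀ - e μ₀| := abs_sub _ _
        _ ≤ η * τ / 4 + η * τ / 4 := add_le_add ep.le e0.le
        _ = η / 2 * τ := by ring
    calc |τ⁻¹ * (e (μ₀ + τ) - e μ₀) - d + ((f L (μ₀ + τ) - e (μ₀ + τ)) - (f L μ₀ - e μ₀)) / τ|
        ≤ |τ⁻¹ * (e (μ₀ + τ) - e μ₀) - d| + |((f L (μ₀ + τ) - e (μ₀ + τ)) - (f L μ₀ - e μ₀)) / τ| :=
          abs_add_le _ _
      _ ≤ η / 2 + η / 2 := add_le_add h1 h2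
      _ = η := by ring
  · have key : (f L μ₀ - f L (μ₀ - τ)) / τ - d =
        ((-τ)⁻¹ * (e (μ₀ + -τ) - e μ₀) - d) + ((f L μ₀ - e μ₀) - (f L (μ₀ - τ) - e (μ₀ - τ))) / τ := by
      rw [← sub_eq_add_neg]
      field_simp
      ring
    rw [key]
    have h1 : |(-τ)⁻¹ * (e (μ₀ + -τ) - e μ₀) - d| ≤ η / 2 := sm.le
    have h2 : |((f L μ₀ - e μ₀) - (f L (μ₀ - τ) - e (μ₀ - τ))) / τ| ≤ η / 2 := by
      rw [abs_div, abs_of_pos hτpos, div_le_iff₀ hτpos]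
      calc |(f L μ₀ - e μ₀) - (f L (μ₀ - τ) - e (μ₀ - τ))|
          ≤ |f L μ₀ - e μ₀| + |f L (μ₀ - τ) - e (μ₀ - τ)| := abs_sub _ _
        _ ≤ η * τ / 4 + η * τ / 4 := add_le_add e0.le em.le
        _ = η / 2 * τ := by ring
    calc |(-τ)⁻¹ * (e (μ₀ + -τ) - e μ₀) - d + ((f L μ₀ - e μ₀) - (f L (μ₀ - τ) - e (μ₀ - τ))) / τ|
        ≤ |(-τ)⁻¹ * (e (μ₀ + -τ) - e μ₀) - d| + |((f L μ₀ - e μ₀) - (f L (μ₀ - τ) - e (μ₀ - τ))) / τ| :=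
          abs_add_le _ _
      _ ≤ η / 2 + η / 2 := add_le_add h1 h2
      _ = η := by ring

/-- Downward walk: `k` one-particle removals, each costing `≤ K`. [folklore] -/
private theorem walk_down (E : ℕ → ℝ) (K : ℝ) (a : ℕ) :
    ∀ k : ℕ, (∀ n : ℕ, a < n → n ≤ a + k → E (n - 1) ≤ E n + K) → E a ≤ E (a + k) + K * k := by
  intro k
  induction k with
  | zero => intro _; simp
  | succ k ih =>
    intro h
    have h1 := ih fun n hn1 hn2 => h n hn1 (by omega)
    have h2 := h (a + k + 1) (by omega) (by omega)
    rw [Nat.add_sub_cancel] at h2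
    rw [← add_assoc]
    push_cast
    linarith

/-- Upward walk: `k` one-particle additions, each costing `≤ K`. [folklore] -/
private theorem walk_up (E : ℕ → ℝ) (K : ℝ) (a : ℕ) :
    ∀ k : ℕ, (∀ n : ℕ, a ≤ n → n < a + k → E (n + 1) ≤ E n + K) → E (a + k) ≤ E a + K * k := by
  intro k
  induction k with
  | zero => intro _; simp
  | succ k ih =>
    intro h
    have h1 := ih fun n hn1 hn2 => h n hn1 (by omega)
    have h2 := h (a + k) (by omega) (by omega)
    rw [← add_assoc]
    push_cast
    linarith

/-- `N_L = 2⌊x/2⌋₊` is within `2` below `x ≥ 0`: `x − 2 ≤ N_L ≤ x`. [folklore] -/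
private theorem two_floor_half_bounds {x : ℝ} (hx : 0 ≤ x) :
    x - 2 ≤ ((2 * ⌊x / 2⌋₊ : ℕ) : ℝ) ∧ ((2 * ⌊x / 2⌋₊ : ℕ) : ℝ) ≤ x := by
  have h1 : (⌊x / 2⌋₊ : ℝ) ≤ x / 2 := Nat.floor_le (by linarith)
  have h2 : x / 2 < (⌊x / 2⌋₊ : ℝ) + 1 := Nat.lt_floor_add_one _
  push_cast
  constructor <;> linarith

/-! ### The closer, abstract core (one side length, reals only) -/

/-- Core of the closer at ONE side length `side ≥ 5`, with every matrix quantity abstracted into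
real numbers: `F` = grand-canonical ground energy as a function of `μ`, `E` = canonical sector
energies (`Esz` the `S^z = 0` ones), `Ns` = a ground sector at `μ₀`, kink inequalities with
tolerance `η`, one-particle costs with constant `C`. Conclusion: hull touch at
`N_L = 2⌊(1−δ)side²/2⌋₊` with error `ε side²`. [folklore] -/
private theorem closer_core (side : ℕ) (hside : 5 ≤ side) (F : ℝ → ℝ) (E Esz : ℕ → ℝ) (C μ₀ τ η δ ε : ℝ)
    (Ns : ℕ) (hC0 : 0 ≤ C) (hτ : 0 < τ) (hη : 0 < η)
    (hδ : δ ∈ Set.Icc (1/10 : ℝ) (2/5 : ℝ)) (hμ₀ : |μ₀| ≤ 4)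
    (hKη : (2 * C + 4) * η = ε / 2) (hSK : 2 * (2 * C + 4) ≤ ε * (side : ℝ) ^ 2 / 2)
    (hNs2 : Ns ≤ 2 * side ^ 2) (hF0 : F μ₀ = E Ns - μ₀ * Ns)
    (hFp : F (μ₀ + τ) ≤ E Ns - (μ₀ + τ) * Ns) (hFm : F (μ₀ - τ) ≤ E Ns - (μ₀ - τ) * Ns)
    (hk1 : |(F (μ₀ + τ) / (side : ℝ) ^ 2 - F μ₀ / (side : ℝ) ^ 2) / τ - -(1 - δ)| ≤ η)
    (hk2 : |(F μ₀ / (side : ℝ) ^ 2 - F (μ₀ - τ) / (side : ℝ) ^ 2) / τ - -(1 - δ)| ≤ η)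
    (hdown : ∀ n : ℕ, 1 ≤ n → n ≤ 2 * side ^ 2 → E (n - 1) ≤ E n + C * (side : ℝ) ^ 2 / n)
    (hup : ∀ n : ℕ, n + 1 ≤ 2 * side ^ 2 →
      E (n + 1) ≤ E n + C * (side : ℝ) ^ 2 / (2 * (side : ℝ) ^ 2 - n))
    (hsz : ∀ N : ℕ, Even N → N ≤ 2 * side ^ 2 → Esz N = E N) :
    Esz (2 * ⌊(1 - δ) * (side : ℝ) ^ 2 / 2⌋₊) - μ₀ * ((2 * ⌊(1 - δ) * (side : ℝ) ^ 2 / 2⌋₊ : ℕ) : ℝ) ≤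
      F μ₀ + ε * (side : ℝ) ^ 2 := by
  -- the scale S = side²
  have hsideR : (5 : ℝ) ≤ (side : ℝ) := by exact_mod_cast hside
  have hSpos : (0 : ℝ) < (side : ℝ) ^ 2 := by positivity
  have hS25 : (25 : ℝ) ≤ (side : ℝ) ^ 2 := by nlinarith
  have hcast2 : ((2 * side ^ 2 : ℕ) : ℝ) = 2 * (side : ℝ) ^ 2 := by push_cast; ring
  set S : ℝ := (side : ℝ) ^ 2 with hS
  have hK : 0 < 2 * C + 4 := by linarith
  have hδ1 : (1 : ℝ) / 10 ≤ δ := hδ.1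
  have hδ2 : δ ≤ 2 / 5 := hδ.2
  have hδS0 : 0 ≤ δ * S := mul_nonneg (by linarith) hSpos.le
  have hδS2 : δ * S ≤ 2 / 5 * S := mul_le_mul_of_nonneg_right hδ2 hSpos.le
  have hηS0 : 0 ≤ η * S := mul_nonneg hη.le hSpos.le
  -- supergradient bracket of Ns from the kink inequalities (expanded, linear in the atoms)
  have hNs_le : (Ns : ℝ) ≤ S - δ * S + η * S := by
    have h1 : -(1 - δ) - η ≤ (F (μ₀ + τ) / S - F μ₀ / S) / τ := by
      have := (abs_le.1 hk1).1; linarith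
    have h2 : (F (μ₀ + τ) / S - F μ₀ / S) / τ ≤ -(Ns : ℝ) / S := by
      rw [div_le_iff₀ hτ, ← sub_div, div_le_iff₀ hSpos]
      have : -(Ns : ℝ) / S * τ * S = -(τ * Ns) := by field_simp
      rw [this]; linarith
    have h3 := h1.trans h2
    rw [le_div_iff₀ hSpos] at h3
    nlinarith
  have hNs_ge : S - δ * S - η * S ≤ (Ns : ℝ) := by
    have h1 : (F μ₀ / S - F (μ₀ - τ) / S) / τ ≤ -(1 - δ) + η := by
      have := (abs_le.1 hk2).2; linarith
    have h2 : -(Ns : ℝ) / S ≤ (F μ₀ / S - F (μ₀ - τ) / S) / τ := by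
      rw [le_div_iff₀ hτ, ← sub_div, le_div_iff₀ hSpos]
      have : -(Ns : ℝ) / S * τ * S = -(τ * Ns) := by field_simp
      rw [this]; linarith
    have h3 := h2.trans h1
    rw [div_le_iff₀ hSpos] at h3
    nlinarith
  -- N_L and its bracket
  have hx : 0 ≤ (1 - δ) * S := by nlinarith
  obtain ⟨hNLlo, hNLhi⟩ := two_floor_half_bounds hx
  set NL : ℕ := 2 * ⌊(1 - δ) * S / 2⌋₊ with hNL
  clear_value NL
  have hNLloR : S - δ * S - 2 ≤ (NL : ℝ) := by linarith
  have hNLhiR : (NL : ℝ) ≤ S - δ * S := by linarith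
  have hNL_nat : NL ≤ 2 * side ^ 2 := by
    have h : (NL : ℝ) ≤ ((2 * side ^ 2 : ℕ) : ℝ) := by rw [hcast2]; linarith
    exact_mod_cast h
  have hdist : |(Ns : ℝ) - NL| ≤ η * S + 2 := by
    rw [abs_le]; constructor <;> linarith
  -- the walk from N* to N_L, each step costing ≤ 2C
  have hwalk : E NL ≤ E Ns + 2 * C * |(Ns : ℝ) - NL| := by
    rcases Nat.lt_or_ge Ns NL with hlt | hle
    · -- walk up from Ns to NL
      obtain ⟨k, hk⟩ : ∃ k, NL = Ns + k := ⟨NL - Ns, by omega⟩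
      have hstep : ∀ n : ℕ, Ns ≤ n → n < Ns + k → E (n + 1) ≤ E n + 2 * C := by
        intro n _ hn2
        have hnNL : n + 1 ≤ NL := by omega
        have hn_lt : n + 1 ≤ 2 * side ^ 2 := le_trans hnNL hNL_nat
        have hcost := hup n hn_lt
        have hnR : (n : ℝ) + 1 ≤ NL := by exact_mod_cast hnNL
        have hnS : (n : ℝ) ≤ S := by linarith
        have hdenpos : 0 < 2 * S - n := by linarith
        have hmul : C * S ≤ C * (2 * (2 * S - n)) := mul_le_mul_of_nonneg_left (by linarith) hC0
        have hbd : C * S / (2 * S - n) ≤ 2 * C := by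
          rw [div_le_iff₀ hdenpos]; linarith
        exact hcost.trans (by linarith)
      have hw := walk_up E (2 * C) Ns k hstep
      rw [← hk] at hw
      have habs : |(Ns : ℝ) - NL| = k := by
        rw [hk]; push_cast; rw [abs_of_nonpos (by linarith)]; ring
      rw [habs]; linarith
    · -- walk down from Ns to NL
      obtain ⟨k, hk⟩ : ∃ k, Ns = NL + k := ⟨Ns - NL, by omega⟩
      have hstep : ∀ n : ℕ, NL < n → n ≤ NL + k → E (n - 1) ≤ E n + 2 * C := by
        intro n hn1 hn2
        have hn_le : n ≤ 2 * side ^ 2 := by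
          have : NL + k ≤ 2 * side ^ 2 := hk ▸ hNs2
          exact le_trans hn2 this
        have hn1' : 1 ≤ n := by omega
        have hcost := hdown n hn1' hn_le
        have hnNL : NL + 1 ≤ n := hn1
        have hnR : (NL : ℝ) + 1 ≤ n := by exact_mod_cast hnNL
        have hnhalf : S ≤ 2 * (n : ℝ) := by linarith
        have hnpos : (0 : ℝ) < n := by linarith
        have hmul : C * S ≤ C * (2 * (n : ℝ)) := mul_le_mul_of_nonneg_left hnhalf hC0
        have hbd : C * S / n ≤ 2 * C := by
          rw [div_le_iff₀ hnpos]; linarith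
        exact hcost.trans (by linarith)
      have hw := walk_down E (2 * C) NL k hstep
      rw [← hk] at hw
      have habs : |(Ns : ℝ) - NL| = k := by
        rw [hk]; push_cast; rw [abs_of_nonneg (by linarith)]; ring
      rw [habs]; linarith
  -- assemble
  have hμterm : μ₀ * ((Ns : ℝ) - NL) ≤ 4 * |(Ns : ℝ) - NL| := by
    calc μ₀ * ((Ns : ℝ) - NL) ≤ |μ₀ * ((Ns : ℝ) - NL)| := le_abs_self _
      _ = |μ₀| * |(Ns : ℝ) - NL| := abs_mul _ _
      _ ≤ 4 * |(Ns : ℝ) - NL| := mul_le_mul_of_nonneg_right hμ₀ (abs_nonneg _)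
  have hKdist : (2 * C + 4) * |(Ns : ℝ) - NL| ≤ (2 * C + 4) * (η * S + 2) :=
    mul_le_mul_of_nonneg_left hdist hK.le
  have hfin : (2 * C + 4) * (η * S + 2) ≤ ε * S := by
    have : (2 * C + 4) * (η * S + 2) = ((2 * C + 4) * η) * S + 2 * (2 * C + 4) := by ring
    rw [this, hKη]; linarith
  have hsplit : (2 * C + 4) * |(Ns : ℝ) - NL| = 2 * C * |(Ns : ℝ) - NL| + 4 * |(Ns : ℝ) - NL| := by
    ring
  rw [hsz NL (hNL ▸ even_two_mul _) hNL_nat]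
  have hexp : E NL - μ₀ * (NL : ℝ) = (E NL - E Ns) + (E Ns - μ₀ * Ns) + μ₀ * ((Ns : ℝ) - NL) := by
    ring
  rw [hexp, ← hF0]
  linarith [hwalk, hμterm, hKdist, hfin, hsplit]

/-! ### The closer -/

/-- **The closer** (`stub_closer` of the registered skeleton). Ground-sector existence + `S^z = 0`
realises the even sector minimum + an `L`-uniform `T = 0` one-particle cost + exposed density at
`T = 0` ⟹ HULL TOUCH at `N_L = 2⌊(1−δ)L²/2⌋₊` with the exposed slope `μ₀` (same `μ₀` for every `ε`).
Kink lemma + supergradient bracket of the grand-canonical ground sector + one-particle walk. -/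
theorem stub_closer :
    (∀ (L : ℕ) [NeZero L] (U μ g : ℝ),
      (∃ N : ℕ, N ≤ 2 * L ^ 2 ∧
        (hubbardTorusWith 2 L 1 U μ - ((g / (L : ℝ) ^ 2 : ℝ) : ℂ) •
          ((pairField dWaveFormFactor L)ᴴ * pairField dWaveFormFactor L)).groundEnergy =
        (hubbardTorus 2 L 1 U - ((g / (L : ℝ) ^ 2 : ℝ) : ℂ) •
          ((pairField dWaveFormFactor L)ᴴ * pairField dWaveFormFactor L)).minEnergyOn
            (nParticleSubmodule N) - μ * N) ∧
      ∀ N : ℕ, N ≤ 2 * L ^ 2 →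
        (hubbardTorusWith 2 L 1 U μ - ((g / (L : ℝ) ^ 2 : ℝ) : ℂ) •
          ((pairField dWaveFormFactor L)ᴴ * pairField dWaveFormFactor L)).groundEnergy ≤
        (hubbardTorus 2 L 1 U - ((g / (L : ℝ) ^ 2 : ℝ) : ℂ) •
          ((pairField dWaveFormFactor L)ᴴ * pairField dWaveFormFactor L)).minEnergyOn
            (nParticleSubmodule N) - μ * N) →
    (∀ (L : ℕ) [NeZero L] (U g : ℝ) (N : ℕ), Even N → N ≤ 2 * L ^ 2 →
      (hubbardTorus 2 L 1 U - ((g / (L : ℝ) ^ 2 : ℝ) : ℂ) •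
        ((pairField dWaveFormFactor L)ᴴ * pairField dWaveFormFactor L)).minEnergyOn
          (szSector N 0) =
      (hubbardTorus 2 L 1 U - ((g / (L : ℝ) ^ 2 : ℝ) : ℂ) •
        ((pairField dWaveFormFactor L)ᴴ * pairField dWaveFormFactor L)).minEnergyOn
          (nParticleSubmodule N)) →
    (∀ (U g : ℝ), 0 ≤ U → 0 ≤ g → ∃ C : ℝ, 0 ≤ C ∧ ∀ (L : ℕ) [NeZero L] (N : ℕ),
      (1 ≤ N → N ≤ 2 * L ^ 2 →
        (hubbardTorus 2 L 1 U - ((g / (L : ℝ) ^ 2 : ℝ) : ℂ) •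
          ((pairField dWaveFormFactor L)ᴴ * pairField dWaveFormFactor L)).minEnergyOn
            (nParticleSubmodule (N - 1)) ≤
        (hubbardTorus 2 L 1 U - ((g / (L : ℝ) ^ 2 : ℝ) : ℂ) •
          ((pairField dWaveFormFactor L)ᴴ * pairField dWaveFormFactor L)).minEnergyOn
            (nParticleSubmodule N) + C * (L : ℝ) ^ 2 / N) ∧
      (N + 1 ≤ 2 * L ^ 2 →
        (hubbardTorus 2 L 1 U - ((g / (L : ℝ) ^ 2 : ℝ) : ℂ) •
          ((pairField dWaveFormFactor L)ᴴ * pairField dWaveFormFactor L)).minEnergyOn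
            (nParticleSubmodule (N + 1)) ≤
        (hubbardTorus 2 L 1 U - ((g / (L : ℝ) ^ 2 : ℝ) : ℂ) •
          ((pairField dWaveFormFactor L)ᴴ * pairField dWaveFormFactor L)).minEnergyOn
            (nParticleSubmodule N) + C * (L : ℝ) ^ 2 / (2 * (L : ℝ) ^ 2 - N))) →
    (∀ δ ∈ Set.Icc (1/10 : ℝ) (2/5 : ℝ), ∃ μ₁ μ₂ : ℝ, -4 < μ₁ ∧ μ₁ ≤ μ₂ ∧ μ₂ < 0 ∧
      ∃ U₀ : ℝ, 0 < U₀ ∧ ∀ U ∈ Set.Ioc (0 : ℝ) U₀, ∀ g ∈ Set.Ioc (0 : ℝ) (1 / 10),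
        ∃ μ₀ ∈ Set.Icc μ₁ μ₂, ∃ e : ℝ → ℝ, ∃ r : ℝ, 0 < r ∧
          (∀ μ ∈ Set.Icc (μ₀ - r) (μ₀ + r),
            Tendsto (fun L : ℕ =>
              (hubbardTorusWith 2 (L + 1) 1 U μ - ((g / ((L + 1 : ℕ) : ℝ) ^ 2 : ℝ) : ℂ) •
                ((pairField dWaveFormFactor (L + 1))ᴴ * pairField dWaveFormFactor (L + 1))).groundEnergy /
                ((L + 1 : ℕ) : ℝ) ^ 2) atTop (𝓝 (e μ))) ∧
          HasDerivAt e (-(1 - δ)) μ₀) →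
    ∀ δ ∈ Set.Icc (1/10 : ℝ) (2/5 : ℝ), ∃ μ₁ μ₂ : ℝ, -4 < μ₁ ∧ μ₁ ≤ μ₂ ∧ μ₂ < 0 ∧ ∃ U₀ : ℝ, 0 < U₀ ∧
      ∀ U ∈ Set.Ioc (0 : ℝ) U₀, ∀ g ∈ Set.Ioc (0 : ℝ) (1 / 10), ∃ μ ∈ Set.Icc μ₁ μ₂, ∀ ε : ℝ, 0 < ε →
        ∃ L₀ : ℕ, ∀ (L : ℕ) [NeZero L], L₀ ≤ L →
          (hubbardTorus 2 L 1 U - ((g / (L : ℝ) ^ 2 : ℝ) : ℂ) •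
            ((pairField dWaveFormFactor L)ᴴ * pairField dWaveFormFactor L)).minEnergyOn
              (szSector (2 * ⌊(1 - δ) * (L : ℝ) ^ 2 / 2⌋₊) 0) -
            μ * ((2 * ⌊(1 - δ) * (L : ℝ) ^ 2 / 2⌋₊ : ℕ) : ℝ) ≤
          (hubbardTorusWith 2 L 1 U μ - ((g / (L : ℝ) ^ 2 : ℝ) : ℂ) •
            ((pairField dWaveFormFactor L)ᴴ * pairField dWaveFormFactor L)).groundEnergy +
            ε * (L : ℝ) ^ 2 := by
  intro hGS hEven hCost hED δ hδ
  obtain ⟨μ₁, μ₂, hμ₁, hμ₁₂, hμ₂, U₀, hU₀, hU⟩ := hED δ hδ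
  refine ⟨μ₁, μ₂, hμ₁, hμ₁₂, hμ₂, U₀, hU₀, fun U hUm g hg => ?_⟩
  obtain ⟨μ₀, hμ₀m, e, r, hr, hlim, hder⟩ := hU U hUm g hg
  refine ⟨μ₀, hμ₀m, fun ε hε => ?_⟩
  obtain ⟨C, hC0, hC⟩ := hCost U g hUm.1.le hg.1.le
  -- constants
  have hKpos : 0 < 2 * C + 4 := by linarith
  set η : ℝ := ε / (2 * (2 * C + 4)) with hη
  have hηpos : 0 < η := by rw [hη]; positivity
  have hKη : (2 * C + 4) * η = ε / 2 := by rw [hη]; field_simp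
  -- kink lemma for f L μ := E₀(Hgc_{L+1}(μ))/(L+1)²
  obtain ⟨τ, hτ, -, L₁, hkink⟩ := kink_lemma
    (fun (L : ℕ) (μ : ℝ) =>
      (hubbardTorusWith 2 (L + 1) 1 U μ - ((g / ((L + 1 : ℕ) : ℝ) ^ 2 : ℝ) : ℂ) •
        ((pairField dWaveFormFactor (L + 1))ᴴ * pairField dWaveFormFactor (L + 1))).groundEnergy /
        ((L + 1 : ℕ) : ℝ) ^ 2)
    e μ₀ (-(1 - δ)) r hr hlim hder η hηpos
  refine ⟨max (L₁ + 1) (max 5 (⌈4 * (2 * C + 4) / ε⌉₊ + 1)), fun L _ hL => ?_⟩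
  have hL1 : L₁ + 1 ≤ L := le_trans (le_max_left _ _) hL
  have hL5 : 5 ≤ L := le_trans (le_trans (le_max_left _ _) (le_max_right _ _)) hL
  have hLK : ⌈4 * (2 * C + 4) / ε⌉₊ + 1 ≤ L :=
    le_trans (le_trans (le_max_right _ _) (le_max_right _ _)) hL
  obtain ⟨L', rfl⟩ : ∃ L', L = L' + 1 := ⟨L - 1, by omega⟩
  obtain ⟨hk1, hk2⟩ := hkink L' (by omega)
  -- the scale condition 2(2C+4) ≤ ε side²/2
  have hSK : 2 * (2 * C + 4) ≤ ε * ((L' + 1 : ℕ) : ℝ) ^ 2 / 2 := by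
    have h1 : (4 * (2 * C + 4) / ε : ℝ) ≤ (⌈4 * (2 * C + 4) / ε⌉₊ : ℝ) := Nat.le_ceil _
    have h2 : ((⌈4 * (2 * C + 4) / ε⌉₊ : ℕ) : ℝ) + 1 ≤ ((L' + 1 : ℕ) : ℝ) := by exact_mod_cast hLK
    have h3 : (1 : ℝ) ≤ ((L' + 1 : ℕ) : ℝ) := by exact_mod_cast (show 1 ≤ L' + 1 by omega)
    have h4 : ((L' + 1 : ℕ) : ℝ) ≤ ((L' + 1 : ℕ) : ℝ) ^ 2 := by nlinarith
    have h5 : 4 * (2 * C + 4) / ε ≤ ((L' + 1 : ℕ) : ℝ) ^ 2 := by linarith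
    rw [div_le_iff₀ hε] at h5
    linarith
  -- the ground sector N* at μ₀ and the supergradient inequalities
  obtain ⟨⟨Ns, hNs2, hF0⟩, -⟩ := hGS (L' + 1) U μ₀ g
  have hFp := (hGS (L' + 1) U (μ₀ + τ) g).2 Ns hNs2
  have hFm := (hGS (L' + 1) U (μ₀ - τ) g).2 Ns hNs2
  have hμ₀abs : |μ₀| ≤ 4 := by
    rw [abs_le]; constructor <;> linarith [hμ₀m.1, hμ₀m.2]
  exact closer_core (L' + 1) hL5
    (fun μ => (hubbardTorusWith 2 (L' + 1) 1 U μ - ((g / ((L' + 1 : ℕ) : ℝ) ^ 2 : ℝ) : ℂ) •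
      ((pairField dWaveFormFactor (L' + 1))ᴴ * pairField dWaveFormFactor (L' + 1))).groundEnergy)
    (fun N => (hubbardTorus 2 (L' + 1) 1 U - ((g / ((L' + 1 : ℕ) : ℝ) ^ 2 : ℝ) : ℂ) •
      ((pairField dWaveFormFactor (L' + 1))ᴴ * pairField dWaveFormFactor (L' + 1))).minEnergyOn
        (nParticleSubmodule N))
    (fun N => (hubbardTorus 2 (L' + 1) 1 U - ((g / ((L' + 1 : ℕ) : ℝ) ^ 2 : ℝ) : ℂ) •
      ((pairField dWaveFormFactor (L' + 1))ᴴ * pairField dWaveFormFactor (L' + 1))).minEnergyOn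
        (szSector N 0))
    C μ₀ τ η δ ε Ns hC0 hτ hηpos hδ hμ₀abs hKη hSK hNs2 hF0
    hFp hFm hk1 hk2 (fun n hn1 hn2 => (hC (L' + 1) n).1 hn1 hn2) (fun n hn => (hC (L' + 1) n).2 hn)
    (fun N hN hN2 => hEven (L' + 1) U g N hN hN2)

end

end Summit.HubbardSuperconductivity.HubbardSuperconductivity.Theorems.TwSeededEnsembleEquivalence.ExposedDensity
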